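import Literature.NumberTheory.Sieve.SmoothRoughDecomposition
import HarnessLib

/-!
# Rough numbers: Buchstab's identity and the elementary counts

Topic `Literature/NumberTheory/Sieve`. Everything here is PROVED (no definitions, no named facts).
For the `N`-rough numbers `roughIcc N X = {1 ≤ b ≤ X : p ∣ b ⇒ p ≥ N}` of
`SmoothRoughDecomposition.lean` (the set counted by `Φ(x, y)` when `N = ⌈y⌉`, `X = ⌊x⌋`):

* `card_roughIcc_eq_card_add_sum` — **Buchstab's identity** (sorting by the least prime factor):
  for `N ≤ M`,
  `#roughIcc N X = #roughIcc M X + ∑_{N ≤ p < M, p prime} #roughIcc p (X / p)`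
  (Harman, *Prime-Detecting Sieves*, (1.4.13): `S(𝓔, z) = S(𝓔, w) − ∑_{w ≤ p < z} S(𝓔_p, p)`;
  Lichtman, proof of Prop. 6.3, "By the Buchstab identity");
* `one_add_card_primes_le_card_roughIcc`, `card_roughIcc_le_two_add_card_primes` — for
  `1 ≤ X ≤ N²` the rough numbers are `1`, the primes in `[N, X]`, and at most one more integer
  (the range `1 ≤ u ≤ 2` of `Φ(x, x^{1/u})`);
* `mem_filter_Ico_ceil_iff` — the index set `{p prime : y ≤ p < w}` as
  `(Ico ⌈y⌉₊ ⌈w⌉₊).filter Nat.Prime` (the trivial bound `#roughIcc N X ≤ X` is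
  `card_roughIcc_le_self` in `PolynomialCongruencesProofs.lean`, or one line from
  `roughIcc_subset_Icc`).

These are the combinatorial inputs of the asymptotic formula `Φ(x, y) ∼ ω(u) x/log y`
(Lichtman's Lemma 6.1) proved in `RoughNumbersBuchstab*.lean`.

## References

* G. Harman, *Prime-Detecting Sieves*, LMS Monographs 33 (2007), §1.4 (1.4.13).
* J. D. Lichtman, *A modification of the linear sieve, and the count of twin primes*,
  arXiv:2109.02851, §6 (Lemma 6.1, proof of Proposition 6.3). [Lichtman2025LinearSieve]
-/

open Finset

namespace Literature.NumberTheory.Sieve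

/-! ### Elementary facts -/

/-- `roughIcc` is antitone in the threshold. [folklore] -/
theorem roughIcc_subset_of_le {N M : ℕ} (h : N ≤ M) (X : ℕ) : roughIcc M X ⊆ roughIcc N X := by
  intro b hb
  rw [mem_roughIcc] at hb ⊢
  exact ⟨hb.1, fun p hp hpb => h.trans (hb.2 p hp hpb)⟩

/-- `1 ∈ roughIcc N X` as soon as `1 ≤ X`. [folklore] -/
theorem one_mem_roughIcc {N X : ℕ} (hX : 1 ≤ X) : 1 ∈ roughIcc N X := by
  rw [mem_roughIcc]
  exact ⟨⟨le_rfl, hX⟩, fun p hp hp1 => absurd (Nat.le_of_dvd one_pos hp1) hp.one_lt.not_ge⟩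

/-- A prime `p` with `N ≤ p ≤ X` is `N`-rough. [folklore] -/
theorem prime_mem_roughIcc {N X p : ℕ} (hp : p.Prime) (hNp : N ≤ p) (hpX : p ≤ X) :
    p ∈ roughIcc N X := by
  rw [mem_roughIcc]
  refine ⟨⟨hp.one_lt.le, hpX⟩, fun q hq hqp => ?_⟩
  rw [(Nat.prime_dvd_prime_iff_eq hq hp).mp hqp]
  exact hNp

/-- The index set `{p prime : y ≤ p < w}` (`y, w` real) is `(Ico ⌈y⌉₊ ⌈w⌉₊).filter Nat.Prime`.
[folklore] -/
theorem mem_filter_Ico_ceil_iff {y w : ℝ} {p : ℕ} :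
    p ∈ (Ico ⌈y⌉₊ ⌈w⌉₊).filter Nat.Prime ↔ p.Prime ∧ y ≤ (p : ℝ) ∧ (p : ℝ) < w := by
  rw [mem_filter, mem_Ico, Nat.ceil_le, Nat.lt_ceil]
  tauto

/-! ### Buchstab's identity -/

/-- The rough numbers counted by `Φ(X, N)` but not by `Φ(X, M)` (`N ≤ M`) are `≠ 1` and have
their least prime factor in `[N, M)`. [folklore] -/
theorem minFac_mem_of_mem_sdiff {N M X b : ℕ} (hb : b ∈ roughIcc N X \ roughIcc M X) :
    b ≠ 1 ∧ b.minFac.Prime ∧ N ≤ b.minFac ∧ b.minFac < M := by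
  rw [mem_sdiff, mem_roughIcc, mem_roughIcc] at hb
  obtain ⟨⟨hbX, hN⟩, hM⟩ := hb
  have hb1 : b ≠ 1 := by
    rintro rfl
    exact hM ⟨hbX, fun p hp hp1 => absurd (Nat.le_of_dvd one_pos hp1) hp.one_lt.not_ge⟩
  have hmf : b.minFac.Prime := Nat.minFac_prime hb1
  refine ⟨hb1, hmf, hN _ hmf (Nat.minFac_dvd b), ?_⟩
  by_contra hge
  push Not at hge
  exact hM ⟨hbX, fun p hp hpb => hge.trans (Nat.minFac_le_of_dvd hp.two_le hpb)⟩

/-- The fibre of the least-prime-factor map over a prime `p ∈ [N, M)`: `b ↦ b / p` is a bijection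
from `{b ∈ roughIcc N X ∖ roughIcc M X : minFac b = p}` onto `roughIcc p (X / p)`. [folklore] -/
theorem card_filter_minFac_eq {N M X p : ℕ} (hp : p.Prime) (hNp : N ≤ p) (hpM : p < M) :
    ((roughIcc N X \ roughIcc M X).filter (fun b => b.minFac = p)).card =
      (roughIcc p (X / p)).card := by
  refine Finset.card_bij' (fun b _ => b / p) (fun c _ => p * c) ?_ ?_ ?_ ?_
  · -- `b / p ∈ roughIcc p (X / p)`
    intro b hb
    rw [mem_filter] at hb
    obtain ⟨hbs, hbm⟩ := hb
    have hbN := (mem_sdiff.mp hbs).1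
    rw [mem_roughIcc] at hbN ⊢
    have hpb : p ∣ b := hbm ▸ Nat.minFac_dvd b
    refine ⟨⟨?_, Nat.div_le_div_right hbN.1.2⟩, fun q hq hqc => ?_⟩
    · exact Nat.div_pos (Nat.le_of_dvd hbN.1.1 hpb) hp.pos
    · have hqb : q ∣ b := hqc.trans (Nat.div_dvd_of_dvd hpb)
      exact hbm ▸ Nat.minFac_le_of_dvd hq.two_le hqb
  · -- `p * c` lies in the fibre
    intro c hc
    rw [mem_roughIcc] at hc
    obtain ⟨⟨hc1, hcX⟩, hcr⟩ := hc
    have hpc_fac : ∀ q : ℕ, q.Prime → q ∣ p * c → p ≤ q := by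
      intro q hq hqpc
      rcases (Nat.Prime.dvd_mul hq).mp hqpc with h | h
      · exact ((Nat.prime_dvd_prime_iff_eq hq hp).mp h).ge
      · exact hcr q hq h
    have hmin : (p * c).minFac = p := by
      apply le_antisymm
      · exact Nat.minFac_le_of_dvd hp.two_le (dvd_mul_right p c)
      · have h1 : p * c ≠ 1 := by
          intro h; exact hp.one_lt.ne' (Nat.eq_one_of_mul_eq_one_right h)
        exact hpc_fac _ (Nat.minFac_prime h1) (Nat.minFac_dvd _)
    rw [mem_filter, mem_sdiff, mem_roughIcc, mem_roughIcc]
    refine ⟨⟨⟨⟨?_, ?_⟩, fun q hq hqpc => hNp.trans (hpc_fac q hq hqpc)⟩, ?_⟩, hmin⟩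
    · exact Nat.mul_pos hp.pos hc1
    · exact (Nat.mul_le_mul_left p hcX).trans (Nat.mul_div_le X p)
    · rintro ⟨-, hM⟩
      exact (hM p hp (dvd_mul_right p c)).not_gt hpM
  · -- left inverse
    intro b hb
    rw [mem_filter] at hb
    have hpb : p ∣ b := hb.2 ▸ Nat.minFac_dvd b
    exact Nat.mul_div_cancel' hpb
  · -- right inverse
    intro c _
    exact Nat.mul_div_cancel_left c hp.pos

/-- **Buchstab's identity for rough numbers** (sorting by the least prime factor): for `N ≤ M`,
`#roughIcc N X = #roughIcc M X + ∑_{p prime, N ≤ p < M} #roughIcc p (X / p)`, i.e.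
`Φ(X, N) = Φ(X, M) + ∑_{N ≤ p < M} Φ(X/p, p)` (Harman (1.4.13) with `𝓔 = [1, X]`).
[cite: Lichtman2025LinearSieve, §6 (proof of Proposition 6.3, "By the Buchstab identity")] -/
theorem card_roughIcc_eq_card_add_sum {N M : ℕ} (hNM : N ≤ M) (X : ℕ) :
    (roughIcc N X).card =
      (roughIcc M X).card + ∑ p ∈ (Ico N M).filter Nat.Prime, (roughIcc p (X / p)).card := by
  have hsub := roughIcc_subset_of_le hNM X
  have hsd : (roughIcc N X \ roughIcc M X).card =
      ∑ p ∈ (Ico N M).filter Nat.Prime, (roughIcc p (X / p)).card := by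
    rw [card_eq_sum_card_fiberwise (f := Nat.minFac) (t := (Ico N M).filter Nat.Prime)]
    · refine sum_congr rfl fun p hp => ?_
      rw [mem_filter, mem_Ico] at hp
      exact card_filter_minFac_eq hp.2 hp.1.1 hp.1.2
    · intro b hb
      obtain ⟨-, hpr, hN, hM⟩ := minFac_mem_of_mem_sdiff hb
      exact mem_filter.mpr ⟨mem_Ico.mpr ⟨hN, hM⟩, hpr⟩
  rw [← hsd, ← card_union_of_disjoint disjoint_sdiff, union_sdiff_of_subset hsub]

/-! ### The count for `X ≤ N²`: `1`, the primes in `[N, X]`, and at most one more -/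

/-- `1 + #{p prime : N ≤ p ≤ X} ≤ #roughIcc N X` for `X ≥ 1`. [folklore] -/
theorem one_add_card_primes_le_card_roughIcc {N X : ℕ} (hX : 1 ≤ X) :
    1 + ((Icc N X).filter Nat.Prime).card ≤ (roughIcc N X).card := by
  have h1 : (1 : ℕ) ∉ (Icc N X).filter Nat.Prime := by simp [Nat.not_prime_one]
  rw [add_comm, ← card_insert_of_notMem h1]
  refine card_le_card fun b hb => ?_
  rw [mem_insert] at hb
  rcases hb with rfl | hb
  · exact one_mem_roughIcc hX
  · rw [mem_filter, mem_Icc] at hb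
    exact prime_mem_roughIcc hb.2 hb.1.1 hb.1.2

/-- An `N`-rough `b` that is neither `1` nor prime is `≥ N²`. [folklore] -/
theorem sq_le_of_mem_roughIcc {N X b : ℕ} (hb : b ∈ roughIcc N X) (hb1 : b ≠ 1)
    (hbp : ¬b.Prime) : N * N ≤ b := by
  rw [mem_roughIcc] at hb
  have hmf := hb.2 _ (Nat.minFac_prime hb1) (Nat.minFac_dvd b)
  have hsq : b.minFac ^ 2 ≤ b := Nat.minFac_sq_le_self hb.1.1 hbp
  calc N * N ≤ b.minFac * b.minFac := Nat.mul_le_mul hmf hmf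
    _ = b.minFac ^ 2 := (sq _).symm
    _ ≤ b := hsq

/-- `#roughIcc N X ≤ 2 + #{p prime : N ≤ p ≤ X}` when `X ≤ N²`: besides `1` and the primes there is
at most one rough integer, necessarily `= N² = X`. [folklore] -/
theorem card_roughIcc_le_two_add_card_primes {N X : ℕ} (hXN : X ≤ N * N) :
    (roughIcc N X).card ≤ 2 + ((Icc N X).filter Nat.Prime).card := by
  classical
  have hsub : roughIcc N X ⊆
      insert 1 (((Icc N X).filter Nat.Prime) ∪ (Icc 1 X).filter (fun b => N * N ≤ b)) := by
    intro b hb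
    rw [mem_insert, mem_union]
    by_cases hb1 : b = 1
    · exact Or.inl hb1
    right
    have hb' := mem_roughIcc.mp hb
    by_cases hbp : b.Prime
    · exact Or.inl (mem_filter.mpr ⟨mem_Icc.mpr ⟨hb'.2 b hbp dvd_rfl, hb'.1.2⟩, hbp⟩)
    · exact Or.inr (mem_filter.mpr ⟨mem_Icc.mpr hb'.1, sq_le_of_mem_roughIcc hb hb1 hbp⟩)
  have hbig : ((Icc 1 X).filter (fun b => N * N ≤ b)).card ≤ 1 := by
    rw [Finset.card_le_one]
    intro a ha b hb
    rw [mem_filter, mem_Icc] at ha hb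
    omega
  calc (roughIcc N X).card ≤ (insert 1 (((Icc N X).filter Nat.Prime) ∪
        (Icc 1 X).filter (fun b => N * N ≤ b))).card := card_le_card hsub
    _ ≤ (((Icc N X).filter Nat.Prime) ∪ (Icc 1 X).filter (fun b => N * N ≤ b)).card + 1 :=
        card_insert_le _ _
    _ ≤ ((Icc N X).filter Nat.Prime).card + ((Icc 1 X).filter (fun b => N * N ≤ b)).card + 1 := by
        gcongr; exact card_union_le _ _
    _ ≤ 2 + ((Icc N X).filter Nat.Prime).card := by omega

end Literature.NumberTheory.Sieve
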